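import Mathlib
import Summits.NavierStokesRegularity.NavierStokesRegularity.Theorems.FilamentSkeletonRssDefectColumnGateAzimuthalBlockAssemblyKit
import Summits.NavierStokesRegularity.NavierStokesRegularity.Theorems.FilamentSkeletonRssDefectColumnGateAzimuthalBlockTools

/-!
# Route `FilamentSkeletonRss` · crux `TransverseReduction1AG` (stmt-NavierStokesRegularity-27853; A1L twin stmt-23297) · line
# `defect_column_gate_1AG/1AL` — PRELIMINARIES for the two-zone assembly of the azimuthal blocks of S2a-loc `WaistColumnGateLoc1A`
# (stage 3 plumbing, part 1): folded-forcing bound, layer integrals by the exterior sup, the exterior inner datum from the core currencies,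
# and the two "re-bounding" algebra lemmas that replace the truncation radius `u₁` by its upper end `u₀ + 2/γ`

Helper file (`--supports stmt-NavierStokesRegularity-27853 --as helper`; seat ns-filament-s2aloc-p1 g2; note ARCHITECTURE-B2B3-s2aloc-g2.md v4 §7c).
Small-context lemmas so that the final assembly (`…TwoZone.lean`) is a short chain.  HONEST FRAMING: elementary lemmas serving ONE family of blocks
of ONE linear MODEL operator of a hypothetical blow-up route (MODEL rung, negative side); nothing here bears on NS regularity.
-/

set_option linter.dupNamespace false

noncomputable section

namespace Summit.NavierStokesRegularity.NavierStokesRegularity.Theorems.DefectColumnGate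

open scoped Topology
open Set Filter MeasureTheory intervalIntegral

/-- **Folded forcing bound.**  With `c_B(u) = (γmRc/2)(γ/4π)e^{−γu/4}` (`m, Rc ≥ 0`), `|φ| ≤ N/m²`, `(1+u)²|f| ≤ M` and `8/γ ≤ 1+u₀ ≤ 1+u`:
`(1+u)²|f − c_Bφ| ≤ M + (γ²Rc/8πm)(1+u₀)²e^{−γu₀/4}N` (and the same for `f + c_Bφ`). -/
theorem folded_forcing_le {γ m Rc u₀ u M N fv φv : ℝ} (hγ : 0 < γ) (hm : 0 < m) (hRc : 0 ≤ Rc) (h8 : 8 / γ ≤ 1 + u₀) (hu : u₀ ≤ u)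
    (hf : (1 + u) ^ 2 * |fv| ≤ M) (hφ : |φv| ≤ N / m ^ 2) (σ : ℝ) (hσ : σ = 1 ∨ σ = -1) :
    (1 + u) ^ 2 * |fv + σ * (γ * m * Rc / 2 * (γ / (4 * Real.pi) * Real.exp (-(γ * u / 4))) * φv)|
      ≤ M + γ ^ 2 * Rc / (8 * Real.pi * m) * ((1 + u₀) ^ 2 * Real.exp (-(γ * u₀ / 4))) * N := by
  have hπ : 0 < Real.pi := Real.pi_pos
  have hdec := sq_mul_exp_neg_antitone hγ h8 hu
  have h8' : 0 < 8 / γ := by positivity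
  have h10 : 0 < 1 + u := by linarith
  set c : ℝ := γ * m * Rc / 2 * (γ / (4 * Real.pi) * Real.exp (-(γ * u / 4))) with hcdef
  have hc0 : 0 ≤ c := by positivity
  have hσ1 : |σ| = 1 := by rcases hσ with h | h <;> simp [h]
  have h1 : |fv + σ * c * φv| ≤ |fv| + c * |φv| := by
    calc |fv + σ * c * φv| ≤ |fv| + |σ * c * φv| := abs_add_le _ _
      _ = |fv| + c * |φv| := by rw [abs_mul, abs_mul, hσ1, abs_of_nonneg hc0, one_mul]
  have h2 : (1 + u) ^ 2 * (c * |φv|) ≤ γ ^ 2 * Rc / (8 * Real.pi * m) * ((1 + u₀) ^ 2 * Real.exp (-(γ * u₀ / 4))) * N := by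
    have e : (1 + u) ^ 2 * (c * |φv|) = γ ^ 2 * Rc / (8 * Real.pi) * m * ((1 + u) ^ 2 * Real.exp (-(γ * u / 4))) * |φv| := by
      simp only [hcdef]; ring
    rw [e]
    have h3 : γ ^ 2 * Rc / (8 * Real.pi) * m * ((1 + u) ^ 2 * Real.exp (-(γ * u / 4))) * |φv|
        ≤ γ ^ 2 * Rc / (8 * Real.pi) * m * ((1 + u₀) ^ 2 * Real.exp (-(γ * u₀ / 4))) * (N / m ^ 2) :=
      mul_le_mul (mul_le_mul_of_nonneg_left hdec (by positivity)) hφ (abs_nonneg _) (by positivity)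
    have e2 : γ ^ 2 * Rc / (8 * Real.pi) * m * ((1 + u₀) ^ 2 * Real.exp (-(γ * u₀ / 4))) * (N / m ^ 2)
        = γ ^ 2 * Rc / (8 * Real.pi * m) * ((1 + u₀) ^ 2 * Real.exp (-(γ * u₀ / 4))) * N := by
      field_simp
    linarith
  have h4 := mul_le_mul_of_nonneg_left h1 (show 0 ≤ (1 + u) ^ 2 by positivity)
  have e3 : σ * (γ * m * Rc / 2 * (γ / (4 * Real.pi) * Real.exp (-(γ * u / 4))) * φv) = σ * c * φv := by
    simp only [hcdef]; ring
  rw [e3]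
  linarith [h4, h2, hf, mul_add ((1 + u) ^ 2) (|fv|) (c * |φv|)]

/-- **Layer integrals by the exterior sup.**  On `L′ = [u₀, u₀ + 3/γ]` (`u₀ > 0`): if `a² + b² ≤ Q/u₀⁴` (`Q ≥ 0`) and `(1+u)²|F_i| ≤ M_E` there, with
`a, b, F₁, F₂` continuous, then the right-hand side of `layer_flux_choice` is
`≤ e^{γ(u₀+3/γ)/4}·(c_Φ·Q/u₀⁴ + (243/8)·M_E²/(1+u₀)⁴)`, `c_Φ = 12((1+36γ²)(u₀+3/γ) + 81γ/32 + 81/64)`. -/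
theorem layer_integrals_le {γ u₀ Q ME : ℝ} {a b F₁ F₂ : ℝ → ℝ} (hγ : 0 < γ) (hu₀ : 0 < u₀)
    (ha : ContinuousOn a (Icc u₀ (u₀ + 3 / γ))) (hb : ContinuousOn b (Icc u₀ (u₀ + 3 / γ)))
    (hF₁ : ContinuousOn F₁ (Icc u₀ (u₀ + 3 / γ))) (hF₂ : ContinuousOn F₂ (Icc u₀ (u₀ + 3 / γ)))
    (hs : ∀ u ∈ Icc u₀ (u₀ + 3 / γ), a u ^ 2 + b u ^ 2 ≤ Q / u₀ ^ 4)
    (hFb₁ : ∀ u ∈ Icc u₀ (u₀ + 3 / γ), (1 + u) ^ 2 * |F₁ u| ≤ ME) (hFb₂ : ∀ u ∈ Icc u₀ (u₀ + 3 / γ), (1 + u) ^ 2 * |F₂ u| ≤ ME) :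
    4 * γ * ((1 + 36 * γ ^ 2) * (∫ u in u₀..(u₀ + 3 / γ), Real.exp (γ * u / 4) * (u * (a u ^ 2 + b u ^ 2)))
        + 81 * γ / 32 * (∫ u in u₀..(u₀ + 3 / γ), Real.exp (γ * u / 4) * (a u ^ 2 + b u ^ 2))
        + 81 / 32 * (∫ u in u₀..(u₀ + 3 / γ), Real.exp (γ * u / 4) * |a u * F₁ u + b u * F₂ u|))
      ≤ Real.exp (γ * (u₀ + 3 / γ) / 4)
        * (12 * ((1 + 36 * γ ^ 2) * (u₀ + 3 / γ) + 81 * γ / 32 + 81 / 64) * (Q / u₀ ^ 4) + 243 / 8 * (ME ^ 2 / (1 + u₀) ^ 4)) := by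
  set r : ℝ := u₀ + 3 / γ with hrdef
  have h3γ : 0 < 3 / γ := by positivity
  have hu₀r : u₀ ≤ r := by rw [hrdef]; linarith
  have hlen : r - u₀ = 3 / γ := by rw [hrdef]; ring
  set Er : ℝ := Real.exp (γ * r / 4) with hErdef
  have hEr0 : 0 < Er := Real.exp_pos _
  have hEc : ContinuousOn (fun u : ℝ => Real.exp (γ * u / 4)) (Icc u₀ r) := (Real.continuous_exp.comp (by continuity)).continuousOn
  have hsc : ContinuousOn (fun u => a u ^ 2 + b u ^ 2) (Icc u₀ r) := (ha.pow 2).add (hb.pow 2)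
  have hE_le : ∀ u ∈ Icc u₀ r, Real.exp (γ * u / 4) ≤ Er := fun u hu => by
    rw [hErdef]; exact Real.exp_le_exp.mpr (by nlinarith [hu.2, hγ])
  have hME0 : 0 ≤ ME := le_trans (by positivity) (hFb₁ u₀ (left_mem_Icc.2 hu₀r))
  -- the three layer integrals
  have hJus : (∫ u in u₀..r, Real.exp (γ * u / 4) * (u * (a u ^ 2 + b u ^ 2))) ≤ 3 / γ * (Er * r * (Q / u₀ ^ 4)) := by
    have h1 : (∫ u in u₀..r, Real.exp (γ * u / 4) * (u * (a u ^ 2 + b u ^ 2))) ≤ ∫ _ in u₀..r, Er * r * (Q / u₀ ^ 4) := by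
      apply integral_mono_on hu₀r ((hEc.mul (continuousOn_id.mul hsc)).intervalIntegrable_of_Icc hu₀r) _root_.intervalIntegrable_const
      intro u hu
      have hs' := hs u hu
      have hs0 : 0 ≤ a u ^ 2 + b u ^ 2 := by positivity
      have hu0 : 0 ≤ u := le_trans hu₀.le hu.1
      calc Real.exp (γ * u / 4) * (u * (a u ^ 2 + b u ^ 2)) ≤ Er * (r * (Q / u₀ ^ 4)) :=
            mul_le_mul (hE_le u hu) (mul_le_mul hu.2 hs' hs0 (le_trans hu₀.le hu₀r)) (by positivity) hEr0.le
        _ = Er * r * (Q / u₀ ^ 4) := by ring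
    rw [intervalIntegral.integral_const, smul_eq_mul, hlen] at h1
    linarith
  have hJs : (∫ u in u₀..r, Real.exp (γ * u / 4) * (a u ^ 2 + b u ^ 2)) ≤ 3 / γ * (Er * (Q / u₀ ^ 4)) := by
    have h1 : (∫ u in u₀..r, Real.exp (γ * u / 4) * (a u ^ 2 + b u ^ 2)) ≤ ∫ _ in u₀..r, Er * (Q / u₀ ^ 4) := by
      apply integral_mono_on hu₀r ((hEc.mul hsc).intervalIntegrable_of_Icc hu₀r) _root_.intervalIntegrable_const
      intro u hu
      have hs0 : 0 ≤ a u ^ 2 + b u ^ 2 := by positivity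
      exact mul_le_mul (hE_le u hu) (hs u hu) hs0 hEr0.le
    rw [intervalIntegral.integral_const, smul_eq_mul, hlen] at h1
    linarith
  have hJf : (∫ u in u₀..r, Real.exp (γ * u / 4) * |a u * F₁ u + b u * F₂ u|)
      ≤ 3 / γ * (Er * (Q / (2 * u₀ ^ 4) + ME ^ 2 / (1 + u₀) ^ 4)) := by
    have h1 : (∫ u in u₀..r, Real.exp (γ * u / 4) * |a u * F₁ u + b u * F₂ u|)
        ≤ ∫ _ in u₀..r, Er * (Q / (2 * u₀ ^ 4) + ME ^ 2 / (1 + u₀) ^ 4) := by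
      apply integral_mono_on hu₀r ((hEc.mul ((ha.mul hF₁).add (hb.mul hF₂)).abs).intervalIntegrable_of_Icc hu₀r)
        _root_.intervalIntegrable_const
      intro u hu
      have hu1 : 0 < 1 + u := by linarith [hu.1]
      have h1u₀ : 0 < 1 + u₀ := by linarith
      have hs' := hs u hu
      have hg₁ : |F₁ u| ≤ ME / (1 + u) ^ 2 := by rw [le_div_iff₀ (by positivity)]; linarith [hFb₁ u hu]
      have hg₂ : |F₂ u| ≤ ME / (1 + u) ^ 2 := by rw [le_div_iff₀ (by positivity)]; linarith [hFb₂ u hu]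
      have hquot : ME / (1 + u) ^ 2 ≤ ME / (1 + u₀) ^ 2 :=
        div_le_div_of_nonneg_left hME0 (by positivity) (pow_le_pow_left₀ h1u₀.le (by linarith [hu.1]) 2)
      have hg₁' : |F₁ u| ≤ ME / (1 + u₀) ^ 2 := hg₁.trans hquot
      have hg₂' : |F₂ u| ≤ ME / (1 + u₀) ^ 2 := hg₂.trans hquot
      have hF1sq : F₁ u ^ 2 ≤ ME ^ 2 / (1 + u₀) ^ 4 := by
        have := pow_le_pow_left₀ (abs_nonneg _) hg₁' 2
        rw [sq_abs, div_pow] at this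
        calc F₁ u ^ 2 ≤ ME ^ 2 / ((1 + u₀) ^ 2) ^ 2 := this
          _ = ME ^ 2 / (1 + u₀) ^ 4 := by ring
      have hF2sq : F₂ u ^ 2 ≤ ME ^ 2 / (1 + u₀) ^ 4 := by
        have := pow_le_pow_left₀ (abs_nonneg _) hg₂' 2
        rw [sq_abs, div_pow] at this
        calc F₂ u ^ 2 ≤ ME ^ 2 / ((1 + u₀) ^ 2) ^ 2 := this
          _ = ME ^ 2 / (1 + u₀) ^ 4 := by ring
      have k : |a u * F₁ u + b u * F₂ u| ≤ ((a u ^ 2 + b u ^ 2) + (F₁ u ^ 2 + F₂ u ^ 2)) / 2 := by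
        rw [abs_le]; constructor
        · nlinarith [sq_nonneg (a u + F₁ u), sq_nonneg (b u + F₂ u)]
        · nlinarith [sq_nonneg (a u - F₁ u), sq_nonneg (b u - F₂ u)]
      have hsum : |a u * F₁ u + b u * F₂ u| ≤ Q / (2 * u₀ ^ 4) + ME ^ 2 / (1 + u₀) ^ 4 := by
        have e : Q / (2 * u₀ ^ 4) = (Q / u₀ ^ 4) / 2 := by field_simp
        rw [e]; linarith [k, hs', hF1sq, hF2sq]
      exact mul_le_mul (hE_le u hu) hsum (abs_nonneg _) hEr0.le
    rw [intervalIntegral.integral_const, smul_eq_mul, hlen] at h1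
    linarith
  have hr0 : 0 ≤ r := le_trans hu₀.le hu₀r
  have e : Real.exp (γ * r / 4) * (12 * ((1 + 36 * γ ^ 2) * r + 81 * γ / 32 + 81 / 64) * (Q / u₀ ^ 4) + 243 / 8 * (ME ^ 2 / (1 + u₀) ^ 4))
      = 4 * γ * ((1 + 36 * γ ^ 2) * (3 / γ * (Er * r * (Q / u₀ ^ 4))) + 81 * γ / 32 * (3 / γ * (Er * (Q / u₀ ^ 4)))
        + 81 / 32 * (3 / γ * (Er * (Q / (2 * u₀ ^ 4) + ME ^ 2 / (1 + u₀) ^ 4)))) := by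
    rw [hErdef]; field_simp; ring
  rw [e]
  have t1 := mul_le_mul_of_nonneg_left hJus (show 0 ≤ 1 + 36 * γ ^ 2 by positivity)
  have t2 := mul_le_mul_of_nonneg_left hJs (show 0 ≤ 81 * γ / 32 by positivity)
  have t3 := mul_le_mul_of_nonneg_left hJf (show (0:ℝ) ≤ 81 / 32 by norm_num)
  have hsum := add_le_add (add_le_add t1 t2) t3
  exact mul_le_mul_of_nonneg_left hsum (by positivity)

/-- **The exterior inner datum from the core currencies (short interval, full Gaussian discount).**  `0 < u₀ − 1/γ`, `u₀ ≤ u₁`, `θ′ > 0`;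
`a, b, a₁, b₁` continuous near `u₀` with `a′ = a₁`, `b′ = b₁`; the Gaussian currencies' integrands interval-integrable on `[0, u₁]`.  Then
`a(u₀)² + b(u₀)² ≤ (e^{1/4}/e^{γu₀/4})·((γ + 1/θ′)·∫₀^{u₁}E(a²+b²) + (θ′/(4(u₀−1/γ)))·∫₀^{u₁}E·4u(a₁²+b₁²))`. -/
theorem datum_le_currencies {γ u₀ u₁ θ' : ℝ} {a a₁ b b₁ : ℝ → ℝ} (hγ : 0 < γ) (hx0 : 0 < u₀ - 1 / γ) (hu₀u₁ : u₀ ≤ u₁) (hθ' : 0 < θ')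
    (ha : ContinuousOn a (Icc (u₀ - 1 / γ) u₀)) (hb : ContinuousOn b (Icc (u₀ - 1 / γ) u₀))
    (ha₁ : ContinuousOn a₁ (Icc (u₀ - 1 / γ) u₀)) (hb₁ : ContinuousOn b₁ (Icc (u₀ - 1 / γ) u₀))
    (hdera : ∀ v ∈ Ioo (u₀ - 1 / γ) u₀, HasDerivAt a (a₁ v) v) (hderb : ∀ v ∈ Ioo (u₀ - 1 / γ) u₀, HasDerivAt b (b₁ v) v)
    (hIE : IntervalIntegrable (fun u => Real.exp (γ * u / 4) * (a u ^ 2 + b u ^ 2)) volume 0 u₁)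
    (hID : IntervalIntegrable (fun u => Real.exp (γ * u / 4) * (4 * u * (a₁ u ^ 2 + b₁ u ^ 2))) volume 0 u₁) :
    a u₀ ^ 2 + b u₀ ^ 2 ≤ Real.exp (1 / 4) / Real.exp (γ * u₀ / 4)
      * ((γ + 1 / θ') * (∫ u in (0:ℝ)..u₁, Real.exp (γ * u / 4) * (a u ^ 2 + b u ^ 2))
        + θ' / (4 * (u₀ - 1 / γ)) * (∫ u in (0:ℝ)..u₁, Real.exp (γ * u / 4) * (4 * u * (a₁ u ^ 2 + b₁ u ^ 2)))) := by
  have hγ' : 0 < 1 / γ := by positivity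
  have hxy : u₀ - 1 / γ < u₀ := by linarith
  have hu₁0 : 0 ≤ u₁ := by linarith
  have hext := sq_le_extraction_short hxy (right_mem_Icc.2 hxy.le) hθ' ha hb ha₁ hb₁ hdera hderb
  have hlen : u₀ - (u₀ - 1 / γ) = 1 / γ := by ring
  rw [hlen, one_div_one_div] at hext
  have hE0pos : 0 < Real.exp (γ * u₀ / 4) := Real.exp_pos _
  have hElow : ∀ v ∈ Icc (u₀ - 1 / γ) u₀, Real.exp (γ * u₀ / 4) ≤ Real.exp (1 / 4) * Real.exp (γ * v / 4) := by
    intro v hv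
    rw [← Real.exp_add]
    apply Real.exp_le_exp.mpr
    have : γ * (u₀ - 1 / γ) = γ * u₀ - 1 := by field_simp
    nlinarith [hv.1, hγ]
  have hsubI : Icc (u₀ - 1 / γ) u₀ ⊆ Icc 0 u₁ := fun v hv => ⟨le_trans hx0.le hv.1, le_trans hv.2 hu₀u₁⟩
  have hsubI' : uIcc (u₀ - 1 / γ) u₀ ⊆ uIcc 0 u₁ := by rw [uIcc_of_le hxy.le, uIcc_of_le hu₁0]; exact hsubI
  have hint_s : ∫ v in (u₀ - 1 / γ)..u₀, (a v ^ 2 + b v ^ 2)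
      ≤ Real.exp (1 / 4) / Real.exp (γ * u₀ / 4) * ∫ u in (0:ℝ)..u₁, Real.exp (γ * u / 4) * (a u ^ 2 + b u ^ 2) := by
    have h1 : ∫ v in (u₀ - 1 / γ)..u₀, (a v ^ 2 + b v ^ 2)
        ≤ ∫ v in (u₀ - 1 / γ)..u₀, Real.exp (1 / 4) / Real.exp (γ * u₀ / 4) * (Real.exp (γ * v / 4) * (a v ^ 2 + b v ^ 2)) := by
      apply integral_mono_on hxy.le (((ha.pow 2).add (hb.pow 2)).intervalIntegrable_of_Icc hxy.le) ((hIE.mono_set hsubI').const_mul _)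
      intro v hv
      have hs : 0 ≤ a v ^ 2 + b v ^ 2 := by positivity
      have h2 := hElow v hv
      have h4 : Real.exp (γ * u₀ / 4) * (a v ^ 2 + b v ^ 2) ≤ Real.exp (1 / 4) * Real.exp (γ * v / 4) * (a v ^ 2 + b v ^ 2) :=
        mul_le_mul_of_nonneg_right h2 hs
      calc a v ^ 2 + b v ^ 2 = 1 / Real.exp (γ * u₀ / 4) * (Real.exp (γ * u₀ / 4) * (a v ^ 2 + b v ^ 2)) := by field_simp
        _ ≤ 1 / Real.exp (γ * u₀ / 4) * (Real.exp (1 / 4) * Real.exp (γ * v / 4) * (a v ^ 2 + b v ^ 2)) :=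
            mul_le_mul_of_nonneg_left h4 (by positivity)
        _ = Real.exp (1 / 4) / Real.exp (γ * u₀ / 4) * (Real.exp (γ * v / 4) * (a v ^ 2 + b v ^ 2)) := by ring
    have h2 : ∫ v in (u₀ - 1 / γ)..u₀, Real.exp (1 / 4) / Real.exp (γ * u₀ / 4) * (Real.exp (γ * v / 4) * (a v ^ 2 + b v ^ 2))
        ≤ Real.exp (1 / 4) / Real.exp (γ * u₀ / 4) * ∫ u in (0:ℝ)..u₁, Real.exp (γ * u / 4) * (a u ^ 2 + b u ^ 2) := by
      rw [intervalIntegral.integral_const_mul]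
      apply mul_le_mul_of_nonneg_left _ (by positivity)
      apply integral_mono_interval hx0.le hxy.le hu₀u₁ _ hIE
      exact MeasureTheory.ae_restrict_of_forall_mem measurableSet_Ioc (fun v _ => by positivity)
    exact h1.trans h2
  have hint_d : ∫ v in (u₀ - 1 / γ)..u₀, (a₁ v ^ 2 + b₁ v ^ 2)
      ≤ Real.exp (1 / 4) / Real.exp (γ * u₀ / 4) * (1 / (4 * (u₀ - 1 / γ)))
        * ∫ u in (0:ℝ)..u₁, Real.exp (γ * u / 4) * (4 * u * (a₁ u ^ 2 + b₁ u ^ 2)) := by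
    have h1 : ∫ v in (u₀ - 1 / γ)..u₀, (a₁ v ^ 2 + b₁ v ^ 2)
        ≤ ∫ v in (u₀ - 1 / γ)..u₀, Real.exp (1 / 4) / Real.exp (γ * u₀ / 4) * (1 / (4 * (u₀ - 1 / γ)))
          * (Real.exp (γ * v / 4) * (4 * v * (a₁ v ^ 2 + b₁ v ^ 2))) := by
      apply integral_mono_on hxy.le (((ha₁.pow 2).add (hb₁.pow 2)).intervalIntegrable_of_Icc hxy.le)
        ((hID.mono_set hsubI').const_mul _)
      intro v hv
      have hw : 0 ≤ a₁ v ^ 2 + b₁ v ^ 2 := by positivity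
      have h2 := hElow v hv
      have e : Real.exp (1 / 4) / Real.exp (γ * u₀ / 4) * (1 / (4 * (u₀ - 1 / γ))) * (Real.exp (γ * v / 4) * (4 * v * (a₁ v ^ 2 + b₁ v ^ 2)))
          = (Real.exp (1 / 4) * Real.exp (γ * v / 4) / Real.exp (γ * u₀ / 4)) * (v / (u₀ - 1 / γ)) * (a₁ v ^ 2 + b₁ v ^ 2) := by
        field_simp
      rw [e]
      have h3 : 1 ≤ Real.exp (1 / 4) * Real.exp (γ * v / 4) / Real.exp (γ * u₀ / 4) := by
        rw [le_div_iff₀ hE0pos]; linarith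
      have h4 : 1 ≤ v / (u₀ - 1 / γ) := by rw [le_div_iff₀ hx0]; linarith [hv.1]
      have h5 := mul_le_mul h3 h4 zero_le_one (by positivity)
      rw [one_mul] at h5
      have h6 := mul_le_mul_of_nonneg_right h5 hw
      rw [one_mul] at h6
      exact h6
    have h2 : ∫ v in (u₀ - 1 / γ)..u₀, Real.exp (1 / 4) / Real.exp (γ * u₀ / 4) * (1 / (4 * (u₀ - 1 / γ)))
          * (Real.exp (γ * v / 4) * (4 * v * (a₁ v ^ 2 + b₁ v ^ 2)))
        ≤ Real.exp (1 / 4) / Real.exp (γ * u₀ / 4) * (1 / (4 * (u₀ - 1 / γ)))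
          * ∫ u in (0:ℝ)..u₁, Real.exp (γ * u / 4) * (4 * u * (a₁ u ^ 2 + b₁ u ^ 2)) := by
      rw [intervalIntegral.integral_const_mul]
      apply mul_le_mul_of_nonneg_left _ (by positivity)
      apply integral_mono_interval hx0.le hxy.le hu₀u₁ _ hID
      exact MeasureTheory.ae_restrict_of_forall_mem measurableSet_Ioc (fun v hv => by
        have : 0 < v := hv.1
        positivity)
    exact h1.trans h2
  have hα : 0 ≤ γ + 1 / θ' := by positivity
  have h2 := mul_le_mul_of_nonneg_left hint_s hα
  have h3 := mul_le_mul_of_nonneg_left hint_d hθ'.le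
  have e : Real.exp (1 / 4) / Real.exp (γ * u₀ / 4)
      * ((γ + 1 / θ') * (∫ u in (0:ℝ)..u₁, Real.exp (γ * u / 4) * (a u ^ 2 + b u ^ 2))
        + θ' / (4 * (u₀ - 1 / γ)) * (∫ u in (0:ℝ)..u₁, Real.exp (γ * u / 4) * (4 * u * (a₁ u ^ 2 + b₁ u ^ 2))))
      = (γ + 1 / θ') * (Real.exp (1 / 4) / Real.exp (γ * u₀ / 4) * ∫ u in (0:ℝ)..u₁, Real.exp (γ * u / 4) * (a u ^ 2 + b u ^ 2))
        + θ' * (Real.exp (1 / 4) / Real.exp (γ * u₀ / 4) * (1 / (4 * (u₀ - 1 / γ)))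
          * ∫ u in (0:ℝ)..u₁, Real.exp (γ * u / 4) * (4 * u * (a₁ u ^ 2 + b₁ u ^ 2))) := by
    field_simp
  rw [e]
  linarith [hext, h2, h3]

/-- **Re-bounding the currency inequality** at the upper end of the layer (pure algebra). -/
theorem rebound_currency {IE K Kb M uE uEb c₁ Rc B₁ Φ₀ κ X : ℝ} (hK : 0 < K) (hKle : K ≤ Kb) (huE : uE ≤ uEb) (huE0 : 0 ≤ uE)
    (hc₁ : 0 < c₁) (hRc : 0 < Rc) (hB : B₁ ≤ Φ₀) (hΦ : 0 ≤ Φ₀) (hκ : 0 ≤ κ) (hX : 0 ≤ X)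
    (h : IE ≤ K * (4 * K * (M ^ 2 * uE) / (c₁ ^ 2 * Rc ^ 2) + 4 * (B₁ + κ * X) / (c₁ * Rc))) :
    IE ≤ Kb * (4 * Kb * (M ^ 2 * uEb) / (c₁ ^ 2 * Rc ^ 2)) + Kb * (4 / (c₁ * Rc)) * Φ₀ + Kb * (4 * κ / (c₁ * Rc)) * X := by
  have hKb : 0 < Kb := lt_of_lt_of_le hK hKle
  have h2 : 4 * (B₁ + κ * X) / (c₁ * Rc) ≤ 4 * (Φ₀ + κ * X) / (c₁ * Rc) := by
    apply div_le_div_of_nonneg_right _ (by positivity); linarith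
  have hin0 : 0 ≤ 4 * K * (M ^ 2 * uE) / (c₁ ^ 2 * Rc ^ 2) + 4 * (Φ₀ + κ * X) / (c₁ * Rc) := by positivity
  have h4 : 4 * K * (M ^ 2 * uE) / (c₁ ^ 2 * Rc ^ 2) ≤ 4 * Kb * (M ^ 2 * uEb) / (c₁ ^ 2 * Rc ^ 2) := by
    apply div_le_div_of_nonneg_right _ (by positivity)
    exact mul_le_mul (by linarith) (mul_le_mul_of_nonneg_left huE (sq_nonneg M)) (by positivity) (by positivity)
  have h5 : IE ≤ Kb * (4 * Kb * (M ^ 2 * uEb) / (c₁ ^ 2 * Rc ^ 2) + 4 * (Φ₀ + κ * X) / (c₁ * Rc)) :=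
    calc IE ≤ K * (4 * K * (M ^ 2 * uE) / (c₁ ^ 2 * Rc ^ 2) + 4 * (Φ₀ + κ * X) / (c₁ * Rc)) := by
          have := mul_le_mul_of_nonneg_left h2 hK.le; linarith
      _ ≤ Kb * (4 * K * (M ^ 2 * uE) / (c₁ ^ 2 * Rc ^ 2) + 4 * (Φ₀ + κ * X) / (c₁ * Rc)) :=
          mul_le_mul_of_nonneg_right hKle hin0
      _ ≤ Kb * (4 * Kb * (M ^ 2 * uEb) / (c₁ ^ 2 * Rc ^ 2) + 4 * (Φ₀ + κ * X) / (c₁ * Rc)) := by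
          have := mul_le_mul_of_nonneg_left (add_le_add_right h4 (4 * (Φ₀ + κ * X) / (c₁ * Rc))) hKb.le; linarith
  have e : Kb * (4 * Kb * (M ^ 2 * uEb) / (c₁ ^ 2 * Rc ^ 2) + 4 * (Φ₀ + κ * X) / (c₁ * Rc))
      = Kb * (4 * Kb * (M ^ 2 * uEb) / (c₁ ^ 2 * Rc ^ 2)) + Kb * (4 / (c₁ * Rc)) * Φ₀ + Kb * (4 * κ / (c₁ * Rc)) * X := by
    field_simp
    ring
  linarith [h5, e]

/-- **Re-bounding the dissipation / sup inequality** at the upper end of the layer (pure algebra). -/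
theorem rebound_dissipation {T K Kb M uE uEb c₁ Rc γ B₁ B₂ Φ₀ κ X : ℝ} (hK : 0 < K) (hKle : K ≤ Kb) (huE : uE ≤ uEb) (huE0 : 0 ≤ uE)
    (hc₁ : 0 < c₁) (hRc : 0 < Rc) (hγ : 0 < γ) (hB : |B₁| + |B₂| ≤ Φ₀) (hκ : 0 ≤ κ) (hX : 0 ≤ X)
    (h : T ≤ M ^ 2 * uE / Rc * (4 * K * ((γ + 1) * K + 4) / c₁ ^ 2 + 1 / 2)
        + 4 * ((γ + 1) * K + 4) * B₁ / c₁ + B₂ + κ * (1 + 4 * ((γ + 1) * K + 4) / c₁) * X) :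
    T ≤ uEb / Rc * (4 * Kb * ((γ + 1) * Kb + 4) / c₁ ^ 2 + 1 / 2) * M ^ 2
        + (4 * ((γ + 1) * Kb + 4) / c₁ + 1) * Φ₀ + κ * (1 + 4 * ((γ + 1) * Kb + 4) / c₁) * X := by
  have hKb : 0 < Kb := lt_of_lt_of_le hK hKle
  have huEb : 0 ≤ uEb := huE0.trans huE
  have hA₂le : 4 * ((γ + 1) * K + 4) / c₁ ≤ 4 * ((γ + 1) * Kb + 4) / c₁ := by
    apply div_le_div_of_nonneg_right _ hc₁.le; nlinarith [hKle, hγ]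
  have hA₂0 : 0 ≤ 4 * ((γ + 1) * K + 4) / c₁ := by positivity
  have hA₁le : M ^ 2 * uE / Rc * (4 * K * ((γ + 1) * K + 4) / c₁ ^ 2 + 1 / 2)
      ≤ uEb / Rc * (4 * Kb * ((γ + 1) * Kb + 4) / c₁ ^ 2 + 1 / 2) * M ^ 2 := by
    have h1 : 4 * K * ((γ + 1) * K + 4) / c₁ ^ 2 + 1 / 2 ≤ 4 * Kb * ((γ + 1) * Kb + 4) / c₁ ^ 2 + 1 / 2 := by
      have : 4 * K * ((γ + 1) * K + 4) ≤ 4 * Kb * ((γ + 1) * Kb + 4) :=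
        mul_le_mul (by linarith) (by nlinarith [hKle, hγ]) (by positivity) (by positivity)
      linarith [div_le_div_of_nonneg_right this (sq_nonneg c₁)]
    have h2 : M ^ 2 * uE / Rc ≤ M ^ 2 * uEb / Rc :=
      div_le_div_of_nonneg_right (mul_le_mul_of_nonneg_left huE (sq_nonneg M)) hRc.le
    calc M ^ 2 * uE / Rc * (4 * K * ((γ + 1) * K + 4) / c₁ ^ 2 + 1 / 2)
        ≤ M ^ 2 * uEb / Rc * (4 * Kb * ((γ + 1) * Kb + 4) / c₁ ^ 2 + 1 / 2) :=
          mul_le_mul h2 h1 (by positivity) (div_nonneg (mul_nonneg (sq_nonneg M) huEb) hRc.le)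
      _ = uEb / Rc * (4 * Kb * ((γ + 1) * Kb + 4) / c₁ ^ 2 + 1 / 2) * M ^ 2 := by ring
  have h2 : 4 * ((γ + 1) * K + 4) * B₁ / c₁ + B₂ ≤ (4 * ((γ + 1) * Kb + 4) / c₁ + 1) * Φ₀ := by
    have e : 4 * ((γ + 1) * K + 4) * B₁ / c₁ = (4 * ((γ + 1) * K + 4) / c₁) * B₁ := by ring
    rw [e]
    have h3 : (4 * ((γ + 1) * K + 4) / c₁) * B₁ ≤ (4 * ((γ + 1) * K + 4) / c₁) * |B₁| :=
      mul_le_mul_of_nonneg_left (le_abs_self _) hA₂0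
    have h4 : (4 * ((γ + 1) * K + 4) / c₁) * |B₁| ≤ (4 * ((γ + 1) * Kb + 4) / c₁) * |B₁| :=
      mul_le_mul_of_nonneg_right hA₂le (abs_nonneg _)
    have h5 : B₂ ≤ |B₂| := le_abs_self _
    have h6 : 0 ≤ 4 * ((γ + 1) * Kb + 4) / c₁ := hA₂0.trans hA₂le
    nlinarith [hB, abs_nonneg B₁, abs_nonneg B₂]
  have h3 : κ * (1 + 4 * ((γ + 1) * K + 4) / c₁) * X ≤ κ * (1 + 4 * ((γ + 1) * Kb + 4) / c₁) * X := by
    apply mul_le_mul_of_nonneg_right _ hX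
    apply mul_le_mul_of_nonneg_left _ (by positivity)
    linarith
  linarith [h, hA₁le, h2, h3]

end Summit.NavierStokesRegularity.NavierStokesRegularity.Theorems.DefectColumnGate

end
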